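import Mathlib
import Literature.Barriers.ValiantsHypothesis.PartialDerivativesDetPermProofs
import Literature.Barriers.ValiantsHypothesis.UnpaddedShiftedPartialsQuadric
import Literature.Barriers.ValiantsHypothesis.AlgebraicNaturalProofs
import Literature.Computability.AlgebraicComplexity.ArithCircuitProofs
import Literature.Computability.AlgebraicComplexity.ST21FormulaComplexityBounds

/-!
# Route BarrierLever — crux `DefinableEquations` (stmt-8745) / item `SingleSizeEquations`
# (stmt-8749): a METHOD WALL — the PARTIAL-DERIVATIVE (catalecticant) RANK METHOD IS SATURATED BY
# A POLYNOMIAL OF LINEAR COMPLEXITY in regime `d = n` (val-np-p5 g10)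

The model axis of the crux (val-np-p5 g3–g9) packages every classical RANK method as an
FSV-natural proof against a RESTRICTED model.  This file records, for the chart, why the oldest
of them — the method of partial derivatives (Nisan–Wigderson 1996; Landsberg 2017 §6.2.2: the
flattening ranks `rank f_{e,d-e} = dim ⟨∂^{=e} f⟩`, tree `shiftedPartialsRank K e 0`) — proves
NOTHING against the crux's class and not even against the LINEAR-size class two rungs below it:

**Theorem (`rank_le_rank_sumSq_pow`, saturation).**  For `n ≥ 1` and every order `e ≤ ⌊n/2⌋`,
the polynomial `Q_n = (x_1² + ⋯ + x_n²)^{⌊n/2⌋}` — degree `≤ n`, fan-in-two complexity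
`≤ 2n + ⌊n/2⌋ ≤ 3n` (`complexity_sumSq_pow_le`), so a member of the linear-size class
`{deg ≤ n, L ≤ 3n}` (`sumSq_pow_mem_linearSize`) and of `SmallCircuits ℂ n b` for `b ≥ 2`, `n ≥ 3`
(`sumSq_pow_mem_smallCircuits`) — has `rank (Q_n)_{e,·} = binom(n+e-1, e)` (Reznick's theorem,
tree `flatteningRank_sumSq_pow`), which is the number of order-`e` operators and hence an upper
bound for `rank g_{e,·}` for EVERY `g ∈ K[x_1, …, x_n]` (`shiftedPartialsRank_zero_le_choose`:
`∂_l g` only depends on the multiset of `l`, `iterPDeriv_perm`).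

**Corollaries (the wall).**  `sublevel_eq_univ_of_linearSize` / `_of_smallCircuits`: a threshold
set `{g : rank g_{e,·} < r}` (`e ≤ n/2`) that contains the linear-size class (resp.
`SmallCircuits ℂ n b`, `b ≥ 2`, `n ≥ 3`) is ALL of `ℂ[x_1..x_n]`; `no_pdRankMethod_linearSize` /
`no_pdRankMethod_smallCircuits`: there is no order `e ≤ n/2` and threshold `r` with
`rank f_{e,·} < r` on the class and `rank g_{e,·} ≥ r` for some target `g`;
`distinguisher_eq_zero_of_pdRankSublevel`: in FSV's vocabulary, a polynomial `D` in the
`N = binom(2n,n)` coefficient variables whose zero set on degree-`≤ n` coefficient vectors is such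
a threshold set and which vanishes on `SmallCircuits ℂ n b` is the ZERO polynomial — so no
distinguisher of this kind is an `IsNaturalProof` against the crux's class, at any level, with
or without Boolean variables (`not_isNaturalProof_of_pdRankSublevel`).  At orders
`⌊n/2⌋ ≤ e ≤ 2⌊n/2⌋` the same saturation holds among HOMOGENEOUS targets of degree `≤ 2⌊n/2⌋`
(§5, Gesmundo–Landsberg's Case 1 `⟨∂^{=e} Q_n⟩ = S^{2⌊n/2⌋-e}`, tree `span_derivSet_sumSq_pow_add`:
`rank_le_rank_sumSq_pow_of_isHomogeneous`, `no_pdRankMethod_smallCircuits_high`); for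
inhomogeneous targets at those orders nothing is claimed.

Placement.  Baur–Strassen's degree method (tree `NaturalProofsAgainstAllLinearSizes`, every
linear size) is NOT a rank method and is unaffected; the partial-derivative MATRIX of a variable
PARTITION (Nisan, Raz: tree `FullRankMethod`, g9) is a different flattening and is unaffected.
What this is NOT: nothing on general size-`n^b` circuits beyond this one method (the crux, b = 2,
is OPEN — Chatterjee–Tengse §1.3 dir. 2) and nothing on `VP ≠ VNP`.  No definitions, no named
facts, standard axioms.  Refs: Gesmundo–Landsberg, Theory Comput. 15 (2019) Thm. 4 (Reznick 1992)
and §1 ("`f_{n,k}` … belong to `VP_e`"); Landsberg 2017 §6.2.4 ("illustrating a weakness of the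
method of partial derivatives"); Forbes–Shpilka–Volk 2018 Def. 1/3.
-/

-- `Summit.ValiantsHypothesis.ValiantsHypothesis.…` repeats a component by the D-0017 layout
-- (single-conjunct summit), which the `dupNamespace` linter flags; the name is mandated.
set_option linter.dupNamespace false

noncomputable section

namespace Summit.ValiantsHypothesis.ValiantsHypothesis.Theorems.BarrierLeverDefinableEquations

open MvPolynomial
open Literature.Computability.AlgebraicComplexity
open Literature.Barriers.ValiantsHypothesis
open scoped BigOperators

namespace PartialDerivativeWall

/-! ## §1 Iterated partials depend only on the multiset of directions; the trivial ceiling -/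

section Ceiling

variable {K : Type*} [Field K] {σ : Type*}

/-- Partial derivatives commute (Schwarz, on coefficients). [folklore] -/
theorem pderiv_pderiv_comm (i j : σ) (p : MvPolynomial σ K) :
    pderiv i (pderiv j p) = pderiv j (pderiv i p) := by
  classical
  rcases eq_or_ne i j with rfl | hij
  · rfl
  ext m
  simp only [coeff_pderiv, Finsupp.add_apply, Finsupp.single_apply, if_neg hij,
    if_neg hij.symm, add_zero]
  rw [add_right_comm m (Finsupp.single i 1) (Finsupp.single j 1)]
  ring

/-- The iterated partial derivative `∂_l f` only depends on the multiset of directions in `l`.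
[folklore] -/
theorem iterPDeriv_perm {l l' : List σ} (h : l.Perm l') (f : MvPolynomial σ K) :
    iterPDeriv l f = iterPDeriv l' f := by
  haveI : LeftCommutative (fun (i : σ) (p : MvPolynomial σ K) => pderiv i p) :=
    ⟨fun i j p => pderiv_pderiv_comm i j p⟩
  unfold iterPDeriv
  exact h.foldr_eq f

/-- The order-`e` derivatives of `f` are indexed by the size-`e` multisets of variables. [folklore] -/
theorem derivSet_subset_range_sym (e : ℕ) (f : MvPolynomial σ K) :
    derivSet e f ⊆ Set.range (fun s : Sym σ e => iterPDeriv s.1.toList f) := by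
  rintro _ ⟨l, hl, rfl⟩
  refine ⟨⟨(l : Multiset σ), by simp [hl]⟩, ?_⟩
  have hperm : ((l : Multiset σ).toList).Perm l :=
    Multiset.coe_eq_coe.1 (Multiset.coe_toList (l : Multiset σ))
  exact iterPDeriv_perm hperm f

/-- **The trivial ceiling of the method**: `rank g_{e,·} = dim ⟨∂^{=e} g⟩ ≤ binom(#σ + e - 1, e)`,
the number of order-`e` partial-derivative operators, for EVERY polynomial `g`.
[cite: LandsbergGCT2017, §6.2.2 (p. 158)] -/
theorem shiftedPartialsRank_zero_le_choose [Fintype σ] (e : ℕ) (g : MvPolynomial σ K) :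
    shiftedPartialsRank K e 0 g ≤ (Fintype.card σ + e - 1).choose e := by
  classical
  set φ : Sym σ e → MvPolynomial σ K := fun s => iterPDeriv s.1.toList g with hφ
  haveI : Module.Finite K (Submodule.span K (Set.range φ)) :=
    Module.Finite.span_of_finite K (Set.finite_range φ)
  rw [shiftedPartialsRank_zero_eq]
  calc Module.finrank K (Submodule.span K (derivSet e g))
      ≤ Module.finrank K (Submodule.span K (Set.range φ)) :=
        Submodule.finrank_mono (Submodule.span_mono (derivSet_subset_range_sym e g))
    _ ≤ Fintype.card (Sym σ e) := finrank_range_le_card φ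
    _ = (Fintype.card σ + e - 1).choose e := Sym.card_sym_eq_choose e

/-- The ceiling for `n` variables: `rank g_{e,·} ≤ binom(n + e - 1, e)` for every
`g ∈ K[x_1, …, x_n]`. [cite: LandsbergGCT2017, §6.2.2 (p. 158)] -/
theorem shiftedPartialsRank_zero_le_choose_fin {n : ℕ} (e : ℕ) (g : MvPolynomial (Fin n) K) :
    shiftedPartialsRank K e 0 g ≤ (n + e - 1).choose e := by
  simpa using shiftedPartialsRank_zero_le_choose e g

end Ceiling

/-! ## §2 The saturating polynomial `Q_n = (x_1² + ⋯ + x_n²)^{⌊n/2⌋}`: degree, complexity, rank -/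

section Quadric

variable {K : Type*} [Field K]

/-- `deg (x_1² + ⋯ + x_n²)^k ≤ 2k`. [folklore] -/
theorem totalDegree_sumSq_pow_le (n k : ℕ) :
    ((∑ j : Fin n, (X j : MvPolynomial (Fin n) K) ^ 2) ^ k).totalDegree ≤ 2 * k := by
  have h2 : (∑ j : Fin n, (X j : MvPolynomial (Fin n) K) ^ 2).totalDegree ≤ 2 := by
    refine (totalDegree_finsetSum _ _).trans (Finset.sup_le fun j _ => ?_)
    refine (totalDegree_pow _ _).trans ?_
    rw [totalDegree_X]
  calc ((∑ j : Fin n, (X j : MvPolynomial (Fin n) K) ^ 2) ^ k).totalDegree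
      ≤ k * (∑ j : Fin n, (X j : MvPolynomial (Fin n) K) ^ 2).totalDegree := totalDegree_pow _ _
    _ ≤ k * 2 := Nat.mul_le_mul_left k h2
    _ = 2 * k := mul_comm k 2

/-- `L((x_1² + ⋯ + x_n²)^k) ≤ 2n + k`: `n` squarings, `n` additions (the tree's `complexity`
charges one gate per summand of a `Finset.sum`), then `k` multiplications by the once-computed
quadric (`SahaThankey2021.complexity_pow_le`). [cite: Burgisser2000, §2.1] -/
theorem complexity_sumSq_pow_le (n k : ℕ) :
    complexity ((∑ j : Fin n, (X j : MvPolynomial (Fin n) K) ^ 2) ^ k) ≤ 2 * n + k := by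
  classical
  have hsq : ∀ j : Fin n, complexity ((X j : MvPolynomial (Fin n) K) ^ 2) ≤ 1 := fun j => by
    rw [pow_two]
    have h := complexity_mul_le_holds (k := K) (X j : MvPolynomial (Fin n) K) (X j)
    rw [complexity_X_holds (k := K) j] at h
    simpa using h
  have hsum : complexity (∑ j : Fin n, (X j : MvPolynomial (Fin n) K) ^ 2) ≤ 2 * n := by
    refine (complexity_finset_sum_le _ _).trans ?_
    calc ∑ j : Fin n, complexity ((X j : MvPolynomial (Fin n) K) ^ 2)
          + (Finset.univ : Finset (Fin n)).card
        ≤ ∑ _j : Fin n, 1 + (Finset.univ : Finset (Fin n)).card :=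
          Nat.add_le_add_right (Finset.sum_le_sum fun j _ => hsq j) _
      _ = 2 * n := by simp [two_mul]
  exact (SahaThankey2021.complexity_pow_le _ k).trans (Nat.add_le_add_right hsum k)

/-- `Q_n = (x_1² + ⋯ + x_n²)^{⌊n/2⌋}` lies in the LINEAR-size class `{deg ≤ n, L ≤ 3n}` of the
route's rung `NaturalProofsAgainstAllLinearSizes` (constant `c = 3`). [cite: Burgisser2000, §2.1] -/
theorem sumSq_pow_mem_linearSize (n : ℕ) :
    ((∑ j : Fin n, (X j : MvPolynomial (Fin n) ℂ) ^ 2) ^ (n / 2)) ∈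
      {f : MvPolynomial (Fin n) ℂ | f.totalDegree ≤ n ∧ complexity f ≤ 3 * n} := by
  refine ⟨(totalDegree_sumSq_pow_le n (n / 2)).trans (by omega), ?_⟩
  exact (complexity_sumSq_pow_le n (n / 2)).trans (by omega)

/-- `Q_n ∈ SmallCircuits ℂ n b` for every `b ≥ 2` once `n ≥ 3` (`3n ≤ n² ≤ n^b`).
[cite: ForbesShpilkaVolk2018, Cor. 5] -/
theorem sumSq_pow_mem_smallCircuits {n b : ℕ} (hn : 3 ≤ n) (hb : 2 ≤ b) :
    ((∑ j : Fin n, (X j : MvPolynomial (Fin n) ℂ) ^ 2) ^ (n / 2)) ∈ SmallCircuits ℂ n b := by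
  obtain ⟨hdeg, hL⟩ := sumSq_pow_mem_linearSize n
  refine ⟨hdeg, hL.trans ?_⟩
  calc 3 * n ≤ n * n := Nat.mul_le_mul_right n hn
    _ = n ^ 2 := (sq n).symm
    _ ≤ n ^ b := Nat.pow_le_pow_right (by omega) hb

/-- Reznick's theorem in the crux's regime: for `n ≥ 1` and `e ≤ ⌊n/2⌋`,
`rank (Q_n)_{e,·} = binom(n + e - 1, e)` over any field of characteristic `0`.
[cite: GesmundoLandsberg2017, Thm. 4] -/
theorem rank_sumSq_pow_eq {n e : ℕ} [CharZero K] (hn : 1 ≤ n) (he : e ≤ n / 2) :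
    shiftedPartialsRank K e 0 ((∑ j : Fin n, (X j : MvPolynomial (Fin n) K) ^ 2) ^ (n / 2)) =
      (n + e - 1).choose e :=
  flatteningRank_sumSq_pow hn he

/-- **Saturation**: for `n ≥ 1` and every order `e ≤ ⌊n/2⌋`, EVERY `g ∈ K[x_1, …, x_n]` has
`rank g_{e,·} ≤ rank (Q_n)_{e,·}` — the partial-derivative measure is maximised, among all
polynomials whatsoever, by a polynomial of linear complexity. [cite: GesmundoLandsberg2017, Thm. 4 and §1] -/
theorem rank_le_rank_sumSq_pow {n e : ℕ} [CharZero K] (hn : 1 ≤ n) (he : e ≤ n / 2)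
    (g : MvPolynomial (Fin n) K) :
    shiftedPartialsRank K e 0 g ≤
      shiftedPartialsRank K e 0 ((∑ j : Fin n, (X j : MvPolynomial (Fin n) K) ^ 2) ^ (n / 2)) := by
  rw [rank_sumSq_pow_eq hn he]
  exact shiftedPartialsRank_zero_le_choose_fin e g

end Quadric

/-! ## §3 The wall: partial-derivative rank thresholds are useless against the linear-size class,
hence against `SmallCircuits ℂ n b`, `b ≥ 2` -/

section Wall

/-- A threshold set `{g : rank g_{e,·} < r}` (`e ≤ n/2`, `n ≥ 1`) containing the linear-size class
`{deg ≤ n, L ≤ 3n}` is everything. [cite: GesmundoLandsberg2017, Thm. 4] -/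
theorem sublevel_eq_univ_of_linearSize {n e r : ℕ} (hn : 1 ≤ n) (he : e ≤ n / 2)
    (h : {f : MvPolynomial (Fin n) ℂ | f.totalDegree ≤ n ∧ complexity f ≤ 3 * n} ⊆
      {g : MvPolynomial (Fin n) ℂ | shiftedPartialsRank ℂ e 0 g < r}) :
    {g : MvPolynomial (Fin n) ℂ | shiftedPartialsRank ℂ e 0 g < r} = Set.univ := by
  refine Set.eq_univ_of_forall fun g => ?_
  exact lt_of_le_of_lt (rank_le_rank_sumSq_pow hn he g) (h (sumSq_pow_mem_linearSize n))

/-- The same for the crux's class: a threshold set `{g : rank g_{e,·} < r}` (`e ≤ n/2`) containing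
`SmallCircuits ℂ n b` (`b ≥ 2`, `n ≥ 3`) is everything. [cite: ForbesShpilkaVolk2018, Cor. 5] -/
theorem sublevel_eq_univ_of_smallCircuits {n b e r : ℕ} (hn : 3 ≤ n) (hb : 2 ≤ b) (he : e ≤ n / 2)
    (h : SmallCircuits ℂ n b ⊆ {g : MvPolynomial (Fin n) ℂ | shiftedPartialsRank ℂ e 0 g < r}) :
    {g : MvPolynomial (Fin n) ℂ | shiftedPartialsRank ℂ e 0 g < r} = Set.univ := by
  refine Set.eq_univ_of_forall fun g => ?_
  exact lt_of_le_of_lt (rank_le_rank_sumSq_pow (by omega) he g)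
    (h (sumSq_pow_mem_smallCircuits hn hb))

/-- **No partial-derivative rank method against linear size** (`n ≥ 1`): there is no order
`e ≤ n/2` and threshold `r` such that every member of `{deg ≤ n, L ≤ 3n}` has `rank f_{e,·} < r`
while some target `g` has `rank g_{e,·} ≥ r`. [cite: GesmundoLandsberg2017, Thm. 4 and §1] -/
theorem no_pdRankMethod_linearSize {n : ℕ} (hn : 1 ≤ n) :
    ¬ ∃ e r : ℕ, e ≤ n / 2 ∧
      (∀ f : MvPolynomial (Fin n) ℂ, f.totalDegree ≤ n → complexity f ≤ 3 * n →
        shiftedPartialsRank ℂ e 0 f < r) ∧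
      ∃ g : MvPolynomial (Fin n) ℂ, r ≤ shiftedPartialsRank ℂ e 0 g := by
  rintro ⟨e, r, he, hcls, g, hg⟩
  obtain ⟨hdeg, hL⟩ := sumSq_pow_mem_linearSize n
  exact absurd ((rank_le_rank_sumSq_pow hn he g).trans_lt (hcls _ hdeg hL)) (not_lt.2 hg)

/-- **No partial-derivative rank method against the crux's class**: for `n ≥ 3`, `b ≥ 2` there is
no order `e ≤ n/2` and threshold `r` with `rank f_{e,·} < r` on `SmallCircuits ℂ n b` and
`rank g_{e,·} ≥ r` for some target `g`. [cite: ForbesShpilkaVolk2018, Cor. 5] -/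
theorem no_pdRankMethod_smallCircuits {n b : ℕ} (hn : 3 ≤ n) (hb : 2 ≤ b) :
    ¬ ∃ e r : ℕ, e ≤ n / 2 ∧
      (∀ f ∈ SmallCircuits ℂ n b, shiftedPartialsRank ℂ e 0 f < r) ∧
      ∃ g : MvPolynomial (Fin n) ℂ, r ≤ shiftedPartialsRank ℂ e 0 g := by
  rintro ⟨e, r, he, hcls, g, hg⟩
  exact absurd ((rank_le_rank_sumSq_pow (by omega) he g).trans_lt
    (hcls _ (sumSq_pow_mem_smallCircuits hn hb))) (not_lt.2 hg)

end Wall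

/-! ## §4 FSV vocabulary: a distinguisher cutting out a partial-derivative rank threshold and
vanishing on `SmallCircuits ℂ n b` is the zero polynomial -/

section FSV

/-- Every point of coefficient space `ℂ^{M_{≤ n}}` is the coefficient vector of a polynomial of
degree `≤ n` (the polynomial `Σ_μ c_μ x^μ`). [cite: ForbesShpilkaVolk2018, Def. 1] -/
theorem exists_coeffVector_eq {n : ℕ} (c : degLEMonomials n → ℂ) :
    ∃ f : MvPolynomial (Fin n) ℂ, f.totalDegree ≤ n ∧ coeffVector (degLEMonomials n) f = c := by
  classical
  haveI : Fintype (degLEMonomials n) := (Finsupp.finite_of_degree_le (σ := Fin n) n).fintype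
  refine ⟨∑ μ : degLEMonomials n, monomial (μ : Fin n →₀ ℕ) (c μ), ?_, ?_⟩
  · refine (totalDegree_finsetSum _ _).trans (Finset.sup_le fun μ _ => ?_)
    refine (totalDegree_monomial_le _ _).trans ?_
    have hμ := μ.2
    simp only [degLEMonomials, Set.mem_setOf_eq, Finsupp.degree] at hμ
    exact hμ
  · funext m
    rw [coeffVector_apply, coeff_sum, Finset.sum_eq_single m]
    · rw [coeff_monomial, if_pos rfl]
    · intro μ _ hne
      rw [coeff_monomial, if_neg (fun h => hne (Subtype.ext h))]
    · intro h; exact absurd (Finset.mem_univ m) h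

/-- **The wall in FSV's vocabulary.**  Let `D` be any polynomial in the `N = binom(2n,n)`
coefficient variables (any size, any degree, Boolean sums included) whose zero set on the
coefficient vectors of degree-`≤ n` polynomials is a partial-derivative rank threshold
`{rank f_{e,·} < r}` with `e ≤ n/2`.  If `D` vanishes on `SmallCircuits ℂ n b` (`b ≥ 2`, `n ≥ 3`),
then `D = 0`. [cite: ForbesShpilkaVolk2018, Def. 1 and Cor. 5] -/
theorem distinguisher_eq_zero_of_pdRankSublevel {n b e r : ℕ} (hn : 3 ≤ n) (hb : 2 ≤ b)
    (he : e ≤ n / 2) (D : MvPolynomial (degLEMonomials n) ℂ)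
    (hD : ∀ f : MvPolynomial (Fin n) ℂ, f.totalDegree ≤ n →
      (eval (coeffVector (degLEMonomials n) f) D = 0 ↔ shiftedPartialsRank ℂ e 0 f < r))
    (hvan : ∀ f ∈ SmallCircuits ℂ n b, eval (coeffVector (degLEMonomials n) f) D = 0) :
    D = 0 := by
  have huniv := sublevel_eq_univ_of_smallCircuits hn hb he (r := r) fun f hf =>
    (hD f hf.1).1 (hvan f hf)
  refine MvPolynomial.funext fun c => ?_
  obtain ⟨f, hfdeg, rfl⟩ := exists_coeffVector_eq c
  rw [map_zero]
  exact (hD f hfdeg).2 (by have := Set.eq_univ_iff_forall.1 huniv f; exact this)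

/-- Hence such a `D` is never an FSV natural proof against `SmallCircuits ℂ n b` — for ANY
distinguisher class `𝒟` (any level `a`, `q = 0` or Boolean sums alike).
[cite: ForbesShpilkaVolk2018, Def. 1] -/
theorem not_isNaturalProof_of_pdRankSublevel {n b e r : ℕ} (hn : 3 ≤ n) (hb : 2 ≤ b)
    (he : e ≤ n / 2) (𝒟 : Set (MvPolynomial (degLEMonomials n) ℂ))
    (D : MvPolynomial (degLEMonomials n) ℂ)
    (hD : ∀ f : MvPolynomial (Fin n) ℂ, f.totalDegree ≤ n →
      (eval (coeffVector (degLEMonomials n) f) D = 0 ↔ shiftedPartialsRank ℂ e 0 f < r)) :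
    ¬ IsNaturalProof (degLEMonomials n) (SmallCircuits ℂ n b) 𝒟 D := by
  rintro ⟨-, hD0, hvan⟩
  exact hD0 (distinguisher_eq_zero_of_pdRankSublevel hn hb he D hD hvan)

/-- The linear-size version: a `D` cutting out `{rank f_{e,·} < r}` (`e ≤ n/2`, `n ≥ 1`) and
vanishing on `{deg ≤ n, L ≤ 3n}` is the zero polynomial. [cite: ForbesShpilkaVolk2018, Def. 1] -/
theorem distinguisher_eq_zero_of_pdRankSublevel_linearSize {n e r : ℕ} (hn : 1 ≤ n)
    (he : e ≤ n / 2) (D : MvPolynomial (degLEMonomials n) ℂ)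
    (hD : ∀ f : MvPolynomial (Fin n) ℂ, f.totalDegree ≤ n →
      (eval (coeffVector (degLEMonomials n) f) D = 0 ↔ shiftedPartialsRank ℂ e 0 f < r))
    (hvan : ∀ f : MvPolynomial (Fin n) ℂ, f.totalDegree ≤ n → complexity f ≤ 3 * n →
      eval (coeffVector (degLEMonomials n) f) D = 0) :
    D = 0 := by
  have huniv := sublevel_eq_univ_of_linearSize hn he (r := r) fun f hf =>
    (hD f hf.1).1 (hvan f hf.1 hf.2)
  refine MvPolynomial.funext fun c => ?_
  obtain ⟨f, hfdeg, rfl⟩ := exists_coeffVector_eq c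
  rw [map_zero]
  exact (hD f hfdeg).2 (Set.eq_univ_iff_forall.1 huniv f)

end FSV

/-! ## §5 Orders above `⌊n/2⌋`: saturation among HOMOGENEOUS targets of degree `≤ 2⌊n/2⌋` -/

section HighOrders

variable {K : Type*} [Field K]

/-- The derivatives of order `e` of a FORM of degree `D` are forms of degree `D - e`, whence
`rank g_{e,·} ≤ binom(n + (D - e) - 1, D - e)` for homogeneous `g` (a trivial ceiling that is
smaller than the operator count once `e > D/2`). [cite: GesmundoLandsberg2017, §4 (Case 1)] -/
theorem shiftedPartialsRank_zero_le_of_isHomogeneous {n e D : ℕ} (g : MvPolynomial (Fin n) K)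
    (hg : g.IsHomogeneous D) :
    shiftedPartialsRank K e 0 g ≤ (n + (D - e) - 1).choose (D - e) := by
  classical
  have h := shiftedPartialsRank_le_card_filter (Z := Finset.univ) hg (Finset.subset_univ _) e 0
  rw [add_zero] at h
  refine h.trans ?_
  calc (((Finset.univ : Finset (Fin n)).finsuppAntidiag (D - e)).filter
          fun μ => D - e ≤ ∑ u ∈ (Finset.univ : Finset (Fin n)), μ u).card
      ≤ ((Finset.univ : Finset (Fin n)).finsuppAntidiag (D - e)).card := Finset.card_filter_le _ _
    _ = (n + (D - e) - 1).choose (D - e) := by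
        rw [Finset.card_finsuppAntidiag_nat_eq_choose, Finset.card_univ, Fintype.card_fin]

/-- Gesmundo–Landsberg's Case 1 for `Q_n`: for `⌊n/2⌋ ≤ e ≤ 2⌊n/2⌋`,
`⟨∂^{=e} Q_n⟩ = S^{2⌊n/2⌋ - e}`, so `rank (Q_n)_{e,·} = binom(n + (2⌊n/2⌋ - e) - 1, 2⌊n/2⌋ - e)`
(`n ≥ 1`, characteristic `0`). [cite: GesmundoLandsberg2017, §4 (Case 1)] -/
theorem rank_sumSq_pow_eq_high {n e : ℕ} [CharZero K] (hn : 1 ≤ n) (hke : n / 2 ≤ e)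
    (he : e ≤ 2 * (n / 2)) :
    shiftedPartialsRank K e 0 ((∑ j : Fin n, (X j : MvPolynomial (Fin n) K) ^ 2) ^ (n / 2)) =
      (n + (2 * (n / 2) - e) - 1).choose (2 * (n / 2) - e) := by
  obtain ⟨j, rfl⟩ : ∃ j, e = n / 2 + j := ⟨e - n / 2, by omega⟩
  have hj : 2 * (n / 2) - (n / 2 + j) = n / 2 - j := by omega
  rw [hj, shiftedPartialsRank_zero_eq, span_derivSet_sumSq_pow_add hn (n / 2) j (by omega),
    finrank_restrictSupport_degree]

/-- **Saturation at high orders, homogeneous targets**: for `n ≥ 1`, `⌊n/2⌋ ≤ e ≤ 2⌊n/2⌋` and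
every HOMOGENEOUS `g` of degree `D ≤ 2⌊n/2⌋` (every degree `≤ n` when `n` is even),
`rank g_{e,·} ≤ rank (Q_n)_{e,·}`.  Nothing is claimed for inhomogeneous targets at these orders.
[cite: GesmundoLandsberg2017, Thm. 4 and §4 (Case 1)] -/
theorem rank_le_rank_sumSq_pow_of_isHomogeneous {n e D : ℕ} [CharZero K] (hn : 1 ≤ n)
    (hke : n / 2 ≤ e) (he : e ≤ 2 * (n / 2)) (g : MvPolynomial (Fin n) K)
    (hg : g.IsHomogeneous D) (hD : D ≤ 2 * (n / 2)) :
    shiftedPartialsRank K e 0 g ≤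
      shiftedPartialsRank K e 0 ((∑ j : Fin n, (X j : MvPolynomial (Fin n) K) ^ 2) ^ (n / 2)) := by
  rw [rank_sumSq_pow_eq_high hn hke he]
  refine (shiftedPartialsRank_zero_le_of_isHomogeneous g hg).trans ?_
  -- `m ↦ binom(n + m - 1, m) = binom(n + m - 1, n - 1)` is monotone in `m`
  have key : ∀ m : ℕ, (n + m - 1).choose m = (n + m - 1).choose (n - 1) := fun m => by
    have : n + m - 1 = m + (n - 1) := by omega
    rw [this]; exact Nat.choose_symm_add
  rw [key, key]
  exact Nat.choose_le_choose _ (by omega)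

/-- The high-order wall (homogeneous targets): for `n ≥ 3`, `b ≥ 2`, `⌊n/2⌋ ≤ e ≤ 2⌊n/2⌋`, there is
no threshold `r` with `rank f_{e,·} < r` on `SmallCircuits ℂ n b` and `rank g_{e,·} ≥ r` for some
homogeneous target `g` of degree `≤ 2⌊n/2⌋`. [cite: ForbesShpilkaVolk2018, Cor. 5] -/
theorem no_pdRankMethod_smallCircuits_high {n b e : ℕ} (hn : 3 ≤ n) (hb : 2 ≤ b)
    (hke : n / 2 ≤ e) (he : e ≤ 2 * (n / 2)) :
    ¬ ∃ r : ℕ, (∀ f ∈ SmallCircuits ℂ n b, shiftedPartialsRank ℂ e 0 f < r) ∧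
      ∃ (g : MvPolynomial (Fin n) ℂ) (D : ℕ), g.IsHomogeneous D ∧ D ≤ 2 * (n / 2) ∧
        r ≤ shiftedPartialsRank ℂ e 0 g := by
  rintro ⟨r, hcls, g, D, hg, hD, hr⟩
  exact absurd ((rank_le_rank_sumSq_pow_of_isHomogeneous (by omega) hke he g hg hD).trans_lt
    (hcls _ (sumSq_pow_mem_smallCircuits hn hb))) (not_lt.2 hr)

end HighOrders

end PartialDerivativeWall

end Summit.ValiantsHypothesis.ValiantsHypothesis.Theorems.BarrierLeverDefinableEquations
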